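import Summits.AtomisticToContinuum.Crystallization.Theorems.OverbindingBudgetAffineFarCorePricingCluster
import Summits.AtomisticToContinuum.Crystallization.Theorems.OverbindingBudgetAffineFarCorePricingLipschitz

/-!
# Overbinding budget — slot Z of the 31280 record, leaf Zr‴b: `NormalCorePricing (1/25)` PROVED

`theorem normalCorePricing_holds : NormalCorePricing (1 / 25)` — the S-sized leaf Zr‴b of the leaf list v14′ of the slot-Z record
`farAggregatePricing_record_of_leaves_v14'` (`…OverbindingBudgetAffineFarFirstShellLabelling`): at a normal good site `i` (`goodSet 12 ε₁ (1/25) δ`,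
not scale-bad) with an exact admissible chart `c` (`IsChart C ε₁ y i c`, `ChartAdmissible (1/25) c`), the chart's reference smooth core prices
the actual smooth core into the good class from below up to `C₂ ε₁`:  `refEnergy c − refTail c − C₂ ε₁ ≤ smoothCore G y i`.

PROOF (matching).  `refEnergy c − refTail c = ½ Σ_{p ∈ W} coreTerm(p)` over the finite chart window `W = {p ∈ 𝓛(c.s) : a₀‖B p‖ ≤ 8.9 nn_i}`
(`tailW = 1` beyond `8.8 c.nn ≤ 8.9 nn_i`; part 1's `finite_window`).  Exactness matches each `p ∈ W` to a site `κ p` within `C ε₁ nn_i` of the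
prediction `y i + a₀ B p`, injectively (chart separation `(7/10) nn_i ≫ 2 C ε₁ nn_i`).  Every reference summand is `≤ 0` (`V ≤ 0` beyond
`47/50 ≤ c.nn`), so the sum only grows when restricted to `W₁ = {p ∈ W : κ p ∈ G}`; on the configuration side every good site within `8.8 nn_i`
of `y i` is some `κ p`, `p ∈ W₁` — it is near SOME prediction (exactness) and the NO-CLUSTER lemma of part 1 (`chart_site_unique`) makes the matched
site unique — and the other good sites carry weight `1 − tailW = 0`.  Summand by summand the two sides differ by `≤ 1.5·10⁶ · C ε₁ nn_i`
(part 2's `core_summand_estimate`: `|Δr|, |Δν| ≤ C ε₁ nn_i`), and `#W ≤ 25³` (unit-separated points of norm `≤ 12`).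
Constants: `εE = 1/(100 (C + 1))` (so `C ε₁ ≤ 1/100`), `C₂ = 25³ · 1.5·10⁶ · (C + 1)`.

[this file: Summit.AtomisticToContinuum.Crystallization, slot Z of the 31280 record, leaf Zr‴b]
-/

namespace Summit.AtomisticToContinuum.Crystallization.Theorems.OverbindingBudgetAffineFarSmoothSplit

open Literature.MathematicalPhysics.StatisticalMechanics
open Literature.Geometry.DiscreteGeometry
open Summit.AtomisticToContinuum.Crystallization.Theorems.OverbindingBudgetAffineLadder
open Summit.AtomisticToContinuum.Crystallization.Theorems.OverbindingBudgetAffineLocalisation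
open scoped Classical

variable {N : ℕ}

/-! ## §1  The chart window and the matching -/

/-- The chart-metric norm of a prediction: `‖a₀ • B p‖ = a₀ ‖B p‖` for `a₀ > 0`. [this file] -/
theorem Chart.norm_smul_eq {c : Chart} (ha₀ : 0 < c.a₀) (p : EuclideanSpace ℝ (Fin 3)) : ‖c.a₀ • c.B p‖ = c.a₀ * ‖c.B p‖ := by
  rw [norm_smul, Real.norm_of_nonneg ha₀.le]

/-- **Injectivity of the matching**: two structure points of the `8.9 nn_i`-window whose predictions are `C ε₁ nn_i`-near the SAME site
coincide (chart separation `(7/10) nn_i`). [this file] -/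
theorem matched_point_unique {C ε₁ : ℝ} {y : Fin N → EuclideanSpace ℝ (Fin 3)} {i : Fin N} {c : Chart} (hchart : IsChart C ε₁ y i c)
    (hadm : ChartAdmissible (1 / 25) c) (hCε : C * ε₁ ≤ 1 / 100) (hnn : 0 < nearestDist y i) {p q : EuclideanSpace ℝ (Fin 3)}
    (hp : p ∈ barlowStacking 1 (Real.sqrt (2 / 3)) c.s) (hq : q ∈ barlowStacking 1 (Real.sqrt (2 / 3)) c.s) {k : Fin N}
    (hkp : dist (y k) (y i + c.a₀ • c.B p) ≤ C * ε₁ * nearestDist y i) (hkq : dist (y k) (y i + c.a₀ • c.B q) ≤ C * ε₁ * nearestDist y i) :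
    p = q := by
  by_contra hne
  have hsep := hchart.sep hadm hCε hp hq hne
  have h1 : dist (c.a₀ • c.B p) (c.a₀ • c.B q) ≤ dist (y k) (y i + c.a₀ • c.B p) + dist (y k) (y i + c.a₀ • c.B q) := by
    rw [← dist_add_left (y i) (c.a₀ • c.B p) (c.a₀ • c.B q)]
    exact dist_triangle_left _ _ _
  nlinarith

/-- **Every near good site is matched**: a site `j` within `9 nn_i` of `y i` is `C ε₁ nn_i`-near the prediction of a structure point `p` with
`a₀‖B p‖ ≤ dist (y j) (y i) + C ε₁ nn_i`. [this file] -/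
theorem site_near_prediction {C ε₁ : ℝ} {y : Fin N → EuclideanSpace ℝ (Fin 3)} {i : Fin N} {c : Chart} (hchart : IsChart C ε₁ y i c)
    (ha₀ : 0 < c.a₀) {j : Fin N} (hj : dist (y j) (y i) ≤ 9 * nearestDist y i) :
    ∃ p ∈ barlowStacking 1 (Real.sqrt (2 / 3)) c.s, dist (y j) (y i + c.a₀ • c.B p) ≤ C * ε₁ * nearestDist y i ∧
      c.a₀ * ‖c.B p‖ ≤ dist (y j) (y i) + C * ε₁ * nearestDist y i := by
  obtain ⟨p, hp, hjp⟩ := hchart.2.1 j hj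
  refine ⟨p, hp, hjp, ?_⟩
  have h1 : dist (y i + c.a₀ • c.B p) (y i) ≤ dist (y i + c.a₀ • c.B p) (y j) + dist (y j) (y i) := dist_triangle _ _ _
  rw [dist_eq_norm, add_sub_cancel_left, Chart.norm_smul_eq ha₀, dist_comm (y i + c.a₀ • c.B p)] at h1
  linarith

/-! ## §2  Summand-by-summand comparison -/

/-- **The matched summands differ by `O(C ε₁ nn_i)`.**  At a normal good site `i` (`nn_i ≥ 0.956`, `nn_i ≤ 2`) with an exact admissible chart
(`C ε₁ ≤ 1/100`), for a structure point `p` of the `8.9 nn_i`-window matched to the site `k`: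
`coreTerm(p) − (1 − tailW nn_i r_{ik}) V(r_{ik}) ≤ 1.5·10⁶ · C ε₁ nn_i` (`p = 0`: both vanish, `k = i`; `p ≠ 0`: part 2's estimate with
`|a₀‖Bp‖ − r_{ik}| ≤ C ε₁ nn_i`, `|c.nn − nn_i| ≤ C ε₁ nn_i`, all lengths `≥ 9/10`). [this file] -/
theorem core_pair_estimate {C ε₁ δ : ℝ} {y : Fin N → EuclideanSpace ℝ (Fin 3)} (hy : Function.Injective y) {i : Fin N}
    (hiG : i ∈ goodSet 12 ε₁ (1 / 25) δ y) (hisb : i ∉ goodScaleBadSet 12 ε₁ (1 / 25) δ y) (hδ : 0 < δ) (hCε0 : 0 ≤ C * ε₁)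
    (hCε : C * ε₁ ≤ 1 / 100) {c : Chart} (hchart : IsChart C ε₁ y i c) (hadm : ChartAdmissible (1 / 25) c)
    {p : EuclideanSpace ℝ (Fin 3)} (hp : p ∈ barlowStacking 1 (Real.sqrt (2 / 3)) c.s) (hp9 : c.a₀ * ‖c.B p‖ ≤ 89 / 10 * nearestDist y i)
    {k : Fin N} (hk : dist (y k) (y i + c.a₀ • c.B p) ≤ C * ε₁ * nearestDist y i) :
    coreTerm c.B c.a₀ c.nn p - (1 - tailW (nearestDist y i) (dist (y i) (y k))) * lennardJones (dist (y i) (y k)) ≤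
      1500000 * (C * ε₁ * nearestDist y i) := by
  have hnn956 : 122 / 125 * (1 - 1 / 50) ≤ nearestDist y i := nearestDist_lb_of_good_not_scaleBad hδ hy hiG hisb
  have hnn2 : nearestDist y i ≤ 2 := (inWindow_of_mem_goodSet hiG).2
  have hnn : 0 < nearestDist y i := by linarith
  have ha₀ := hadm.2.1
  have hcnn := hchart.nn_bounds
  by_cases hp0 : p = 0
  · -- both summands vanish
    subst hp0
    have hk0 : k = i := by
      by_contra hki
      have h1 := nearestDist_le_dist y hki
      rw [map_zero, smul_zero, add_zero] at hk
      rw [dist_comm] at h1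
      nlinarith
    subst hk0
    unfold coreTerm
    rw [map_zero, norm_zero, mul_zero, dist_self, lennardJones_zero, mul_zero, mul_zero, sub_zero]
    positivity
  · have hmin := hadm.2.2.2.2.1 p hp hp0
    have hr : 9 / 10 ≤ c.a₀ * ‖c.B p‖ := by nlinarith
    have hdr : |c.a₀ * ‖c.B p‖ - dist (y i) (y k)| ≤ C * ε₁ * nearestDist y i := by
      have h1 := abs_dist_sub_le (y i + c.a₀ • c.B p) (y k) (y i)
      rw [dist_eq_norm (y i + c.a₀ • c.B p) (y i), add_sub_cancel_left, Chart.norm_smul_eq ha₀, dist_comm (y k) (y i),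
        dist_comm (y i + c.a₀ • c.B p)] at h1
      exact h1.trans hk
    have hdr' := abs_le.mp hdr
    have hr' : 9 / 10 ≤ dist (y i) (y k) := by nlinarith
    have hr'ν : dist (y i) (y k) ≤ 10 * nearestDist y i := by nlinarith
    have hν : 9 / 10 ≤ c.nn := by nlinarith
    have hνν : |c.nn - nearestDist y i| ≤ C * ε₁ * nearestDist y i := hchart.1
    have h := core_summand_estimate hν (by linarith) hr hr' hr'ν hdr hνν
    unfold coreTerm
    exact (le_abs_self _).trans h

/-! ## §3  The count of the chart window -/

/-- **The `8.9 nn_i`-window has at most `25³` structure points**: they are `1`-separated and of norm `≤ 12`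
(`‖p‖ ≤ (25/22)‖B p‖`, `a₀ ≥ (25/28) c.nn ≥ (25/28)(99/100) nn_i`). [this file] -/
theorem window_card_le {C ε₁ : ℝ} {y : Fin N → EuclideanSpace ℝ (Fin 3)} {i : Fin N} {c : Chart} (hchart : IsChart C ε₁ y i c)
    (hadm : ChartAdmissible (1 / 25) c) (hCε : C * ε₁ ≤ 1 / 100) (hnn : 0 < nearestDist y i) (W : Finset (EuclideanSpace ℝ (Fin 3)))
    (hW : ∀ p ∈ W, p ∈ barlowStacking 1 (Real.sqrt (2 / 3)) c.s ∧ c.a₀ * ‖c.B p‖ ≤ 89 / 10 * nearestDist y i) :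
    (W.card : ℝ) ≤ 15625 := by
  have hs := hadm.1
  have ha₀ := hadm.2.1
  have hsc := hadm.nn_le_scale
  have hcnn := hchart.nn_bounds.1
  have hB := (near_iso_bounds hadm.2.2.2.1).1
  have h1 : ∀ p ∈ W, dist p 0 ≤ 12 := by
    intro p hpW
    obtain ⟨-, hp9⟩ := hW p hpW
    rw [dist_zero_right]
    have h2 : c.a₀ * (22 / 25 * ‖p‖) ≤ c.a₀ * ‖c.B p‖ := mul_le_mul_of_nonneg_left (hB p) ha₀.le
    have h3 : c.a₀ * ‖p‖ ≤ c.a₀ * 12 := by nlinarith [norm_nonneg p]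
    exact le_of_mul_le_mul_left h3 ha₀
  have h2 : ∀ p ∈ W, ∀ q ∈ W, p ≠ q → (1 : ℝ) ≤ dist p q := by
    intro p hpW q hqW hne
    by_contra hlt
    push Not at hlt
    exact hne (eq_of_dist_lt_one hs (hW p hpW).1 (hW q hqW).1 hlt)
  have h3 := card_le_of_separated_of_dist_le W 0 one_pos (by norm_num : (0 : ℝ) ≤ 12) h1 h2
  rw [finrank_euclideanSpace_fin] at h3
  norm_num at h3
  exact_mod_cast h3

/-! ## §4  ★ Zr‴b PROVED -/

/-- **★ Zr‴b (PROVED): `NormalCorePricing (1/25)`** — with `εE = 1/(100 (C + 1))` and `C₂ = 25³ · 1.5·10⁶ · (C + 1)`.  See the file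
docstring for the matching argument. [this file] -/
theorem normalCorePricing_holds : NormalCorePricing (1 / 25) := by
  intro C hC
  refine ⟨15625 * 1500000 * (C + 1), 1 / (100 * (C + 1)), by positivity, by positivity, ?_⟩
  intro ε₁ hε₁ hε₁E δ hδ hδ2 N y hy i hiG hisb c hchart hadm
  -- constants
  have hC1 : 0 < C + 1 := by linarith
  have hε : ε₁ ≤ 1 / 100 := hε₁E.trans (one_div_le_one_div_of_le (by norm_num) (by nlinarith))
  have hCε : C * ε₁ ≤ 1 / 100 := by
    have h1 : C * ε₁ ≤ C * (1 / (100 * (C + 1))) := mul_le_mul_of_nonneg_left hε₁E hC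
    have h2 : C * (1 / (100 * (C + 1))) ≤ 1 / 100 := by
      rw [mul_one_div, div_le_iff₀ (by positivity)]; nlinarith
    linarith
  have hCε0 : 0 ≤ C * ε₁ := mul_nonneg hC hε₁.le
  have hnn956 : 122 / 125 * (1 - 1 / 50) ≤ nearestDist y i := nearestDist_lb_of_good_not_scaleBad hδ hy hiG hisb
  have hnn2 : nearestDist y i ≤ 2 := (inWindow_of_mem_goodSet hiG).2
  have hnn : 0 < nearestDist y i := by linarith
  have hs := hadm.1
  have ha₀ := hadm.2.1
  have hcnn0 := hadm.2.2.1
  have hcnn := hchart.nn_bounds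
  set L := barlowStacking 1 (Real.sqrt (2 / 3)) c.s with hL
  -- the window
  have hWfin : {p | p ∈ L ∧ c.a₀ * ‖c.B p‖ ≤ 89 / 10 * nearestDist y i}.Finite := by
    refine (finite_window c.s (25 / 22 * (89 / 10 * nearestDist y i) / c.a₀)).subset fun p hp => ⟨hp.1, ?_⟩
    rw [dist_zero_right, le_div_iff₀ ha₀]
    have h1 := (near_iso_bounds hadm.2.2.2.1).1 p
    nlinarith [hp.2]
  set W := hWfin.toFinset with hW_def
  have hW : ∀ p, p ∈ W ↔ p ∈ L ∧ c.a₀ * ‖c.B p‖ ≤ 89 / 10 * nearestDist y i := fun p => by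
    rw [hW_def, Set.Finite.mem_toFinset]; rfl
  -- the matching
  set κ : EuclideanSpace ℝ (Fin 3) → Fin N := fun p =>
    if h : p ∈ L ∧ c.a₀ * ‖c.B p‖ ≤ 9 * nearestDist y i then Classical.choose (hchart.2.2 p h.1 h.2) else i with hκ_def
  have hκ : ∀ p ∈ W, dist (y (κ p)) (y i + c.a₀ • c.B p) ≤ C * ε₁ * nearestDist y i := by
    intro p hpW
    obtain ⟨hpL, hp9⟩ := (hW p).1 hpW
    have h : p ∈ L ∧ c.a₀ * ‖c.B p‖ ≤ 9 * nearestDist y i := ⟨hpL, by linarith⟩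
    have e : κ p = Classical.choose (hchart.2.2 p h.1 h.2) := by rw [hκ_def]; exact dif_pos h
    rw [e]
    exact Classical.choose_spec (hchart.2.2 p h.1 h.2)
  set G := goodSet 12 ε₁ (1 / 25) δ y with hG_def
  set W₁ := W.filter fun p => κ p ∈ G with hW₁_def
  have hinj : Set.InjOn κ ↑W₁ := by
    intro p hp q hq hpq
    rw [Finset.mem_coe, hW₁_def, Finset.mem_filter] at hp hq
    have h1 := hκ p hp.1
    rw [hpq] at h1
    exact matched_point_unique hchart hadm hCε hnn ((hW p).1 hp.1).1 ((hW q).1 hq.1).1 h1 (hκ q hq.1)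
  -- (A) the reference core as a finite sum, and its sign
  set f := coreTerm c.B c.a₀ c.nn with hf_def
  have hA : refEnergy c - refTail c = 1 / 2 * ∑ p ∈ W, f p := by
    rw [refEnergy_sub_refTail_eq hadm, tsum_eq_sum (s := W) (fun p hpW => ?_)]
    · congr 1
      exact Finset.sum_congr rfl fun p hpW => Set.indicator_of_mem ((hW p).1 hpW).1 f
    · by_cases hpL : p ∈ L
      · rw [Set.indicator_of_mem hpL]
        have hp9 : 89 / 10 * nearestDist y i < c.a₀ * ‖c.B p‖ := by
          by_contra hle; push Not at hle; exact hpW ((hW p).2 ⟨hpL, hle⟩)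
        show coreTerm c.B c.a₀ c.nn p = 0
        unfold coreTerm
        rw [tailW_eq_one hcnn0 (by nlinarith), sub_self, zero_mul]
      · exact Set.indicator_of_notMem hpL f
  have hfle : ∀ p ∈ W, f p ≤ 0 := by
    intro p hpW
    obtain ⟨hpL, -⟩ := (hW p).1 hpW
    by_cases hp0 : p = 0
    · rw [hp0, hf_def]
      unfold coreTerm
      rw [map_zero, norm_zero, mul_zero, lennardJones_zero, mul_zero]
    · exact coreTerm_nonpos_of_ge (by nlinarith [hadm.2.2.2.2.1 p hpL hp0])
  have hA1 : ∑ p ∈ W, f p ≤ ∑ p ∈ W₁, f p := by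
    rw [← Finset.sum_filter_add_sum_filter_not W (fun p => κ p ∈ G) f]
    have h0 : ∑ p ∈ W.filter (fun p => ¬ κ p ∈ G), f p ≤ 0 :=
      Finset.sum_nonpos fun p hp => hfle p (Finset.mem_filter.mp hp).1
    linarith
  -- (B) the configuration side as the sum over the matching
  set g : Fin N → ℝ := fun j => (1 - tailW (nearestDist y i) (dist (y i) (y j))) * lennardJones (dist (y i) (y j)) with hg_def
  have himG : W₁.image κ ⊆ G := by
    intro j hj
    rw [Finset.mem_image] at hj
    obtain ⟨p, hp, rfl⟩ := hj
    exact (Finset.mem_filter.mp hp).2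
  have hB : ∑ j ∈ G, g j = ∑ p ∈ W₁, g (κ p) := by
    rw [← Finset.sum_sdiff himG, Finset.sum_image hinj]
    have h0 : ∑ j ∈ G \ W₁.image κ, g j = 0 := by
      refine Finset.sum_eq_zero fun j hj => ?_
      rw [Finset.mem_sdiff] at hj
      obtain ⟨hjG, hjim⟩ := hj
      have hfar : 44 / 5 * nearestDist y i ≤ dist (y i) (y j) := by
        by_contra hlt
        push Not at hlt
        obtain ⟨p, hpL, hjp, hp9⟩ := site_near_prediction hchart ha₀ (j := j) (by rw [dist_comm]; linarith)
        have hpW : p ∈ W := (hW p).2 ⟨hpL, by rw [dist_comm] at hp9; nlinarith⟩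
        have hκj : κ p = j := chart_site_unique hy hiG hδ hε hCε hchart hadm hpL
          (by rw [Chart.norm_smul_eq ha₀]; exact ((hW p).1 hpW).2) (hκ p hpW) hjp
        exact hjim (Finset.mem_image.mpr ⟨p, Finset.mem_filter.mpr ⟨hpW, by rw [hκj]; exact hjG⟩, hκj⟩)
      show (1 - tailW (nearestDist y i) (dist (y i) (y j))) * lennardJones (dist (y i) (y j)) = 0
      rw [tailW_eq_one hnn hfar, sub_self, zero_mul]
    rw [h0, zero_add]
  -- (C) summand by summand, and the count
  have hC' : ∑ p ∈ W₁, f p ≤ ∑ p ∈ W₁, g (κ p) + W₁.card * (1500000 * (C * ε₁ * nearestDist y i)) := by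
    have h1 : ∑ p ∈ W₁, f p ≤ ∑ p ∈ W₁, (g (κ p) + 1500000 * (C * ε₁ * nearestDist y i)) := by
      refine Finset.sum_le_sum fun p hp => ?_
      have hpW := (Finset.mem_filter.mp hp).1
      obtain ⟨hpL, hp9⟩ := (hW p).1 hpW
      have := core_pair_estimate hy hiG hisb hδ hCε0 hCε hchart hadm hpL hp9 (hκ p hpW)
      show coreTerm c.B c.a₀ c.nn p ≤ (1 - tailW (nearestDist y i) (dist (y i) (y (κ p)))) * lennardJones (dist (y i) (y (κ p))) +
        1500000 * (C * ε₁ * nearestDist y i)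
      linarith
    rw [Finset.sum_add_distrib, Finset.sum_const, nsmul_eq_mul] at h1
    exact h1
  have hcard : (W₁.card : ℝ) ≤ 15625 :=
    le_trans (by exact_mod_cast Finset.card_filter_le W _) (window_card_le hchart hadm hCε hnn W fun p hp => (hW p).1 hp)
  -- assemble
  show refEnergy c - refTail c - 15625 * 1500000 * (C + 1) * ε₁ ≤ 1 / 2 * ∑ j ∈ G, g j
  rw [hA, hB]
  have h1 : (W₁.card : ℝ) * (1500000 * (C * ε₁ * nearestDist y i)) ≤ 15625 * (1500000 * (C * ε₁ * 2)) := by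
    have h2 : 1500000 * (C * ε₁ * nearestDist y i) ≤ 1500000 * (C * ε₁ * 2) := by nlinarith
    exact mul_le_mul hcard h2 (by positivity) (by norm_num)
  nlinarith

end Summit.AtomisticToContinuum.Crystallization.Theorems.OverbindingBudgetAffineFarSmoothSplit
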